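import Summits.MatrixMultiplication.MatrixMultiplication.Theorems.SoloBlindRelativeKoszulCwCube
import Literature.Computability.AlgebraicComplexity.BorderRankCWKoszulPowerQ2Proofs
import HarnessLib

/-!
# The relative door at `j = 1` is never tight: certified Koszul exclusions for all powers of `T_{cw,2}`

`Summits/MatrixMultiplication/MatrixMultiplication/Theorems` (soloist file, blind arm).

The RELATIVE (common-factor) door for `T = T_{cw,2}`: a degeneration
`⟨m⟩ ⊠ T^{⊠1} ⊵ T^{⊠d} ⊠ T^{⊠1}` gives `R̃(T)^d ≤ m` (`SoloBlindRelativeRestriction.lean` for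
restrictions; the degeneration form is its companion file), so the TIGHT value `m = 3^d` would give
`R̃(T_{cw,2}) = 3`, i.e. `ω = 2`, and any `m < 3.2688^d` would improve the known bounds on `ω`.
`SoloBlindRelativeKoszul.lean` proved the obstruction `⟨m⟩ ⊠ S ⊵ X ⟹ rank K_M(X) ≤ m · F(S)` for every
`(q,p)`-Koszul flattening, and `SoloBlindRelativeKoszulCwCube.lean` read the tree's `(5,2)` certificate
`265` of the cube as `m ≥ 12` at `d = 2`.

Here the tree's STRONGER certificate — rank `≥ 902` for the torus-weight restricted `(7,3)` flattening
of the cube of the `xyz`-tensor `X ≤ T_{cw,2}` (`xyzCube_koszulRank_ge`) — is propagated to ALL powers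
on the Koszul-rank level (CGLV Prop. 3.2: after `Φ ⊗ α^{⊗N}` the flattening of `X^{⊠3} ⊠ X^{⊠N}` is
`K_Φ(X^{⊠3}) ⊗ X^{⊠N}(α^{⊗N})ᵀ`, of rank `≥ 902 · 3^N`), transported to `X^{⊠(3+N)}` along
`Fin.appendEquiv`, and fed into the relative obstruction with the crude `S`-side
`C(6,3) · R(T^{⊠1}) ≤ 80`:

* `soloKos_xyz_koszul_kronecker_ge` — `902 · 3^N ≤ rank K_{Φ⊗α^{⊗N}}(X^{⊠3} ⊠ X^{⊠N})`;
* `soloKos_xyzPow_koszul_ge` — the same for `X^{⊠(3+N)}` after the append relabelling;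
* `soloKos_cwTwo_pow_not_relDegeneration` — **`⟨m⟩ ⊠ T^{⊠1} ⋭ T^{⊠L}` whenever `L ≥ 3` and
  `80 m < 902 · 3^{L-3}`**;
* `soloKos_cwTwo_relativeDoor_never_tight` — **for every `d ≥ 1`, `⟨3^d⟩ ⊠ T^{⊠1} ⋭ T^{⊠d} ⊠ T^{⊠1}`**:
  no one-step relative identity with common factor `T^{⊠1}` can certify `R̃(T_{cw,2}) = 3`
  (`d = 1` from the tree's certificate `85` for the square, `d ≥ 2` from `902`: `80 · 3^d = 720 · 3^{d-2}
  < 902 · 3^{d-2}`);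
* `soloKos_cwTwo_relativeDoor_one_three`, `…_one_four` — the windows `d = 3, 4` need `m ≥ 34`, resp.
  `m ≥ 102` (the exponent-improving ranges are `m ≤ 34`, resp. `m ≤ 114`).

Context (not formalised): generic modular ranks suggest the true thresholds `m ≥ 14 (d=2)`, `m ≥ 41 (d=3)`.

References: A. Conner, F. Gesmundo, J.M. Landsberg, E. Ventura, *Rank and border rank of Kronecker powers
of tensors and Strassen's laser method*, comput. complexity 31 (2022), Prop. 3.2, Thm. 1.2;
J.M. Landsberg, G. Ottaviani, *Equations for secant varieties of Veronese and other varieties*, Ann. Mat.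
Pura Appl. 192 (2013); J. Alman, *Limits on the universal method for matrix multiplication*, Theory of
Computing 17 (2021), §2.4 (degenerations).
-/

noncomputable section

open scoped BigOperators Polynomial Matrix
open Matrix

namespace Summit.MatrixMultiplication.MatrixMultiplication.Theorems

open Literature.Computability.AlgebraicComplexity
open Literature.Barriers.MatrixMultiplication

/-! ## The `X`-side: `902 · 3^N` for every power -/

section XSide

/-- **Koszul rank of `X^{⊠3} ⊠ X^{⊠N}` after `Φ ⊗ α^{⊗N}`** (`Φ` = the torus-weight restriction
`xyzMArrow`, `α = a₀^* + a₁^* + a₂^*`): it is `rank K_Φ(X^{⊠3}) · rank X^{⊠N}(α^{⊗N}) ≥ 902 · 3^N`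
(CGLV Prop. 3.2, proof; `X(α) = J - I` is invertible). [cite: ConnerGesmundoLandsbergVentura2022, Prop. 3.2 (proof)] -/
theorem soloKos_xyz_koszul_kronecker_ge (N : ℕ) :
    902 * 3 ^ N ≤ (koszulFlattening 3
      (tensorCovector (p := 3) (xyzMArrow.mulVecLin) (powCovector (fun _ => (1 : ℂ)) N))
      (kroneckerTensor (kroneckerPow (xyzTensor ℂ) 3) (kroneckerPow (xyzTensor ℂ) N))).rank := by
  classical
  have h := congrArg Matrix.rank (koszulFlattening_tensorCovector_reindex 3 (xyzMArrow.mulVecLin)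
    (powCovector (fun _ => (1 : ℂ)) N) (kroneckerPow (xyzTensor ℂ) 3) (kroneckerPow (xyzTensor ℂ) N))
  rw [Matrix.rank_reindex, matRank_kroneckerMap_mul, Matrix.rank_transpose,
    contractFirst_powCovector_kroneckerPow,
    Matrix.rank_of_isUnit _ (isUnit_powMatrix isUnit_contractFirst_xyzTensor N), Fintype.card_fun,
    Fintype.card_fin, Fintype.card_fin] at h
  rw [h]
  have h3 : 902 ≤ (koszulFlattening 3 xyzMArrow.mulVecLin (kroneckerPow (xyzTensor ℂ) 3)).rank := by
    rw [koszulFlattening_kroneckerPow_three_xyz_bridge, Matrix.rank_submatrix]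
    exact xyzCube_koszulRank_ge
  exact Nat.mul_le_mul_right _ h3

/-- **The same flattening read on `X^{⊠(3+N)}`**: relabelling `X^{⊠3} ⊠ X^{⊠N} ≅ X^{⊠(3+N)}` along
`Fin.appendEquiv` on the three index sets (the `A`-relabelling is absorbed into the restriction map,
the `B`, `C`-relabellings permute columns and rows). [folklore] -/
theorem soloKos_xyzPow_koszul_ge (N : ℕ) :
    902 * 3 ^ N ≤ (koszulFlatteningGen (2 * 3 + 1) 3
      (LinearMap.toMatrix'
        ((tensorCovector (p := 3) (xyzMArrow.mulVecLin) (powCovector (fun _ => (1 : ℂ)) N)) ∘ₗ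
          LinearMap.funLeft ℂ ℂ (Fin.appendEquiv 3 N))).mulVecLin
      (kroneckerPow (xyzTensor ℂ) (3 + N))).rank := by
  classical
  rw [← Matrix.toLin'_apply', Matrix.toLin'_toMatrix', koszulFlatteningGen_two_mul_add_one]
  have hsub := koszulFlattening_comp_submatrix 3
    (tensorCovector (p := 3) (xyzMArrow.mulVecLin) (powCovector (fun _ => (1 : ℂ)) N))
    ((tensorCovector (p := 3) (xyzMArrow.mulVecLin) (powCovector (fun _ => (1 : ℂ)) N)) ∘ₗ
      LinearMap.funLeft ℂ ℂ (Fin.appendEquiv 3 N))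
    (kroneckerPow (xyzTensor ℂ) (3 + N)) (Fin.appendEquiv 3 N) (Fin.appendEquiv 3 N)
    (Fin.appendEquiv 3 N) (fun v => rfl)
  rw [kroneckerPow_add_reindex] at hsub
  have hrank := Matrix.rank_submatrix
    (koszulFlattening 3 ((tensorCovector (p := 3) (xyzMArrow.mulVecLin)
      (powCovector (fun _ => (1 : ℂ)) N)) ∘ₗ LinearMap.funLeft ℂ ℂ (Fin.appendEquiv 3 N))
      (kroneckerPow (xyzTensor ℂ) (3 + N)))
    (Equiv.prodCongr (Equiv.refl (PSub (2 * 3 + 1) (3 + 1))) (Fin.appendEquiv 3 N))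
    (Equiv.prodCongr (Equiv.refl (PSub (2 * 3 + 1) 3)) (Fin.appendEquiv 3 N))
  have hrank' : (koszulFlattening 3
      (tensorCovector (p := 3) (xyzMArrow.mulVecLin) (powCovector (fun _ => (1 : ℂ)) N))
      (kroneckerTensor (kroneckerPow (xyzTensor ℂ) 3) (kroneckerPow (xyzTensor ℂ) N))).rank =
      (koszulFlattening 3 ((tensorCovector (p := 3) (xyzMArrow.mulVecLin)
        (powCovector (fun _ => (1 : ℂ)) N)) ∘ₗ LinearMap.funLeft ℂ ℂ (Fin.appendEquiv 3 N))
        (kroneckerPow (xyzTensor ℂ) (3 + N))).rank := by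
    rw [hsub]
    exact hrank
  rw [← hrank']
  exact soloKos_xyz_koszul_kronecker_ge N

end XSide

/-! ## The exclusions -/

section Door

/-- **`⟨m⟩ ⊠ T_{cw,2}^{⊠1} ⋭ T_{cw,2}^{⊠L}` whenever `L ≥ 3` and `80 m < 902 · 3^{L-3}`**:
`T_{cw,2}^{⊠L} ≥ X^{⊠L}`, the relative Koszul obstruction at `(q,p) = (7,3)` with the `X`-side
`902 · 3^{L-3}` and the `S`-side `C(6,3) · R(T^{⊠1}) ≤ 20 · 4`. [new] -/
theorem soloKos_cwTwo_pow_not_relDegeneration {L m : ℕ} (hL : 3 ≤ L)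
    (hm : 80 * m < 902 * 3 ^ (L - 3)) :
    ¬ PolyDegeneratesTo (kroneckerTensor (unitTensor ℂ m) (kroneckerPow (cwTensor ℂ 2) 1))
        (kroneckerPow (cwTensor ℂ 2) L) := by
  classical
  obtain ⟨N, rfl⟩ : ∃ N, L = 3 + N := ⟨L - 3, by omega⟩
  have hN : 3 + N - 3 = N := by omega
  rw [hN] at hm
  intro h
  have h' : PolyDegeneratesTo (kroneckerTensor (unitTensor ℂ m) (kroneckerPow (cwTensor ℂ 2) 1))
      (kroneckerPow (xyzTensor ℂ) (3 + N)) :=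
    h.trans_restrictsTo (tensorRestrictsTo_cwTensor_xyzTensor.kroneckerPow (3 + N))
  have hX := soloKos_relativeKoszul_tensorRank (2 * 3 + 1) 3 _ _ m h'
    (LinearMap.toMatrix'
      ((tensorCovector (p := 3) (xyzMArrow.mulVecLin) (powCovector (fun _ => (1 : ℂ)) N)) ∘ₗ
        LinearMap.funLeft ℂ ℂ (Fin.appendEquiv 3 N)))
  have h4 : tensorRank (kroneckerPow (cwTensor ℂ 2) 1) ≤ 4 := by
    simpa using tensorRank_kroneckerPow_cwTensor_two_le_four_pow 1
  have hc : (2 * 3 + 1 - 1).choose 3 = 20 := by decide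
  rw [hc] at hX
  have hge := soloKos_xyzPow_koszul_ge N
  have hm4 : m * (20 * tensorRank (kroneckerPow (cwTensor ℂ 2) 1)) ≤ m * (20 * 4) :=
    Nat.mul_le_mul_left m (Nat.mul_le_mul_left 20 h4)
  generalize 3 ^ N = P at *
  omega

/-- `T^{⊠(d+1)}`-targets transfer to `T^{⊠d} ⊠ T^{⊠1}`-targets (the format of the relative door).
[folklore] -/
theorem soloKos_cwTwo_relDoor_of_pow {d m : ℕ}
    (h : ¬ PolyDegeneratesTo (kroneckerTensor (unitTensor ℂ m) (kroneckerPow (cwTensor ℂ 2) 1))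
        (kroneckerPow (cwTensor ℂ 2) (d + 1))) :
    ¬ PolyDegeneratesTo (kroneckerTensor (unitTensor ℂ m) (kroneckerPow (cwTensor ℂ 2) 1))
        (kroneckerTensor (kroneckerPow (cwTensor ℂ 2) d) (kroneckerPow (cwTensor ℂ 2) 1)) :=
  fun h' => h (h'.trans_restrictsTo
    (tensorMonRestrictsTo_kroneckerPow_add' (cwTensor ℂ 2) d 1).tensorRestrictsTo)

/-- The tree's certified `(5,2)` rank `85` of the SQUARE, restated for `koszulFlatteningGen 5 2`.
[cite: ConnerGesmundoLandsbergVentura2022, §3.3 (first paragraph)] -/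
theorem soloKos_cwTwoSq_koszulGen_ge :
    85 ≤ (koszulFlatteningGen 5 2 (cglvPhiSq2 ℂ).mulVecLin (kroneckerPow (cwTensor ℂ 2) 2)).rank := by
  have h := CGLV2022_koszulRank_sq_two_holds
  unfold CGLV2022_koszulRank_sq_two at h
  rw [← koszulFlatteningGen_two_mul_add_one 2] at h
  exact h

/-- **`⟨3⟩ ⊠ T_{cw,2}^{⊠1} ⋭ T_{cw,2}^{⊠2}`** (the tight case `d = 1`): `85 > 72 = 3 · C(4,2) · 4`. [new] -/
theorem soloKos_cwTwo_sq_not_relDegeneration_three {m : ℕ} (hm : m ≤ 3) :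
    ¬ PolyDegeneratesTo (kroneckerTensor (unitTensor ℂ m) (kroneckerPow (cwTensor ℂ 2) 1))
        (kroneckerPow (cwTensor ℂ 2) 2) := by
  intro h
  have hX := soloKos_relativeKoszul_tensorRank 5 2 _ _ m h (cglvPhiSq2 ℂ)
  have h4 : tensorRank (kroneckerPow (cwTensor ℂ 2) 1) ≤ 4 := by
    simpa using tensorRank_kroneckerPow_cwTensor_two_le_four_pow 1
  have hc : (5 - 1).choose 2 = 6 := by decide
  rw [hc] at hX
  have h85 := soloKos_cwTwoSq_koszulGen_ge
  have : m * (6 * tensorRank (kroneckerPow (cwTensor ℂ 2) 1)) ≤ 3 * (6 * 4) :=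
    Nat.mul_le_mul hm (Nat.mul_le_mul_left 6 h4)
  omega

/-- **The relative door with common factor `T^{⊠1}` is never tight**: for every `d ≥ 1`,
`⟨3^d⟩ ⊠ T_{cw,2}^{⊠1} ⋭ T_{cw,2}^{⊠d} ⊠ T_{cw,2}^{⊠1}` — the one identity of this format that would
give `R̃(T_{cw,2})^d ≤ 3^d`, i.e. `ω = 2`, does not exist, for any `d` (kernel-certified from the
tree's Koszul certificates `85` and `902`). [new] -/
theorem soloKos_cwTwo_relativeDoor_never_tight (d : ℕ) (hd : 1 ≤ d) :
    ¬ PolyDegeneratesTo (kroneckerTensor (unitTensor ℂ (3 ^ d)) (kroneckerPow (cwTensor ℂ 2) 1))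
        (kroneckerTensor (kroneckerPow (cwTensor ℂ 2) d) (kroneckerPow (cwTensor ℂ 2) 1)) := by
  refine soloKos_cwTwo_relDoor_of_pow ?_
  rcases Nat.lt_or_ge d 2 with h2 | h2
  · obtain rfl : d = 1 := by omega
    exact soloKos_cwTwo_sq_not_relDegeneration_three (by norm_num)
  · obtain ⟨e, rfl⟩ : ∃ e, d = e + 2 := ⟨d - 2, by omega⟩
    refine soloKos_cwTwo_pow_not_relDegeneration (by omega) ?_
    have he : e + 2 + 1 - 3 = e := by omega
    rw [he, pow_add]
    have hp : 0 < 3 ^ e := pow_pos (by norm_num) e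
    generalize 3 ^ e = P at *
    omega

/-- **Window `d = 3` needs `m ≥ 34`**: `⟨m⟩ ⊠ T^{⊠1} ⋭ T^{⊠3} ⊠ T^{⊠1}` for `m ≤ 33`
(`80 · 33 = 2640 < 2706 = 902 · 3`); the exponent-improving range of this window is `m ≤ 34`, so at
most `m = 34` survives the certificate. [new] -/
theorem soloKos_cwTwo_relativeDoor_one_three {m : ℕ} (hm : m ≤ 33) :
    ¬ PolyDegeneratesTo (kroneckerTensor (unitTensor ℂ m) (kroneckerPow (cwTensor ℂ 2) 1))
        (kroneckerTensor (kroneckerPow (cwTensor ℂ 2) 3) (kroneckerPow (cwTensor ℂ 2) 1)) :=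
  soloKos_cwTwo_relDoor_of_pow (soloKos_cwTwo_pow_not_relDegeneration (by norm_num)
    (by norm_num; omega))

/-- **Window `d = 4` needs `m ≥ 102`**: `⟨m⟩ ⊠ T^{⊠1} ⋭ T^{⊠4} ⊠ T^{⊠1}` for `m ≤ 101`
(`80 · 101 = 8080 < 8118 = 902 · 9`; the exponent-improving range is `m ≤ 114`). [new] -/
theorem soloKos_cwTwo_relativeDoor_one_four {m : ℕ} (hm : m ≤ 101) :
    ¬ PolyDegeneratesTo (kroneckerTensor (unitTensor ℂ m) (kroneckerPow (cwTensor ℂ 2) 1))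
        (kroneckerTensor (kroneckerPow (cwTensor ℂ 2) 4) (kroneckerPow (cwTensor ℂ 2) 1)) :=
  soloKos_cwTwo_relDoor_of_pow (soloKos_cwTwo_pow_not_relDegeneration (by norm_num)
    (by norm_num; omega))

end Door

end Summit.MatrixMultiplication.MatrixMultiplication.Theorems

end
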